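import Mathlib
import Summits.NavierStokesRegularity.NavierStokesRegularity.Theorems.WakeRatchetTailRatchetScalarFrontPositiveWake
import Summits.NavierStokesRegularity.NavierStokesRegularity.Theorems.WakeRatchetAdmissibleEternalBoundDyadic
import HarnessLib

/-!
# Single-profile DSS waves of the dyadic member ARE scalar fronts (inverse dictionary), hence are
# STRICTLY sub-unitary with a positive wake; `DyadicScalarFronts` ⟺ persistent single-profile dyadic DSS waves

The tree's dictionary `WakeRatchetDyadicFront.isDSSWave_dyadic_of_scalarFront` turns a scalar front profile
`a` (the object of the construction item `DyadicScalarFronts` of stmt-NavierStokesRegularity-21808) into an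
admissible single-profile DSS wave `Φ(x) = e^{−x}a(−e^{−x})e₀` of `dyadicTable`.  This file inverts it: for
ANY admissible single-profile DSS wave of the dyadic member (`IsDSSWave ε₀ dyadicTable 1 T Φ`, one profile,
trivial shape permutation) the off-diagonal components vanish (`apply_eq_zero_of_ne`, from the tree's
`WakeRatchetDyadic.dyadic_apply_ne_zero` through `dssEmbed`) and the scalar
`a(t) = e^{x}(Φ 0 x)_0`, `x = −log(−t)`, satisfies every clause of `DyadicScalarFronts` with `s = e^{T}`
(`front_hasDerivAt`, `front_integrableOn`, `front_bdd`).  Consequences: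

* `DyadicScalarFronts_iff` — the construction item is EXACTLY the existence, at arbitrarily small scale ratios,
  of a non-trivial admissible single-profile DSS wave of the dyadic member (the scalar reduction loses nothing);
* `dssMu_lt_one` — every non-trivial admissible single-profile DSS wave of the dyadic member is STRICTLY
  sub-unitary, `dssMu ε₀ T < 1` (the tree's `IsDSSWave.dssMu_le_one` gives `≤ 1` on every cancelling table;
  strictness comes from the no-perfect-conveyor theorem `WakeRatchetScalarFrontPositiveWake.dssMu_lt_one_of_front`);
* `wake_pos` — and it strands a positive wake: `e^{x}(Φ 0 x)_0 → L > 0` as `x → +∞`.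

HONEST FRAMING: statements about a MODEL lattice ODE (Tao 2016 §1.2, §4); existence of such waves stays open;
nothing here concerns the Navier–Stokes equations; no item is closed.
-/

noncomputable section

set_option linter.dupNamespace false

namespace Summit.NavierStokesRegularity.NavierStokesRegularity.Theorems

namespace WakeRatchetDyadicWaveStrict

open Filter Topology Set MeasureTheory
open Literature.Analysis.FluidPDE Literature.Analysis.FluidPDE.TaoCascade
open WakeRatchetDyadicFront WakeRatchetDyadic WakeRatchetScalarFront WakeRatchetScalarFrontAdmissible
  WakeRatchetScalarFrontPositiveWake

variable {ε₀ T : ℝ} {Φ : Fin 1 → ℝ → Em 4}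

/-- The eternal solution carried by a single-profile wave: shell `n` holds the profile delayed by `nT`.
[cite: Tao2016AveragedNS, §4 Lemma 4.1 (4.8); cell vocabulary (`dssEmbed`)] -/
theorem embed_apply (T : ℝ) (Φ : Fin 1 → ℝ → Em 4) (n : ℤ) (σ : ℝ) :
    dssEmbed (1 : Equiv.Perm (Fin 1)) T Φ 0 n σ = Φ 0 (σ - n * T) := by
  simp [dssEmbed]

/-- **Off-diagonal components of a single-profile dyadic DSS wave vanish.**
[cite: Tao2016AveragedNS, §1.2, §4 Lemma 4.1 (4.8); cell theorem (`WakeRatchetDyadic.dyadic_apply_ne_zero`)] -/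
theorem apply_eq_zero_of_ne (hε : 0 < ε₀) (hW : IsDSSWave ε₀ dyadicTable (1 : Equiv.Perm (Fin 1)) T Φ)
    {i : Fin 4} (hi : i ≠ 0) (x : ℝ) : Φ 0 x i = 0 := by
  have hE : IsEternalVisc ε₀ 0 dyadicTable (dssEmbed (1 : Equiv.Perm (Fin 1)) T Φ 0) :=
    (hW.isEternal_dssEmbed 0).isEternalVisc
  have h := dyadic_apply_ne_zero hε hE 0 hi x
  rwa [embed_apply, Int.cast_zero, zero_mul, sub_zero] at h

/-- The norm of the profile is the modulus of its `0`-component. [elementary] -/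
theorem norm_eq_abs (hε : 0 < ε₀) (hW : IsDSSWave ε₀ dyadicTable (1 : Equiv.Perm (Fin 1)) T Φ) (x : ℝ) :
    ‖Φ 0 x‖ = |Φ 0 x 0| := by
  have h : Φ 0 x = (Φ 0 x 0) • EuclideanSpace.single (0 : Fin 4) (1 : ℝ) := by
    ext i
    by_cases hi : i = 0
    · subst hi; simp
    · rw [apply_eq_zero_of_ne hε hW hi x]; simp [hi]
  calc ‖Φ 0 x‖ = ‖(Φ 0 x 0) • EuclideanSpace.single (0 : Fin 4) (1 : ℝ)‖ := congrArg _ h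
    _ = |Φ 0 x 0| := by rw [norm_smul, Real.norm_eq_abs]; simp

/-- **The scalar profile equation** of component `0` in log-time:
`φ' = −φ + Λφ(·+T)² − Λ⁻¹φ·φ(·−T)`. [cite: Tao2016AveragedNS, §1.2, §4 Lemma 4.1 (4.8); cell theorem] -/
theorem hasDerivAt_comp0 (hW : IsDSSWave ε₀ dyadicTable (1 : Equiv.Perm (Fin 1)) T Φ)
    (x : ℝ) : HasDerivAt (fun x => Φ 0 x 0)
      (bigLam ε₀ * Φ 0 (x + T) 0 ^ 2 - (bigLam ε₀)⁻¹ * (Φ 0 x 0 * Φ 0 (x - T) 0) - Φ 0 x 0) x := by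
  have hE : IsEternalVisc ε₀ 0 dyadicTable (dssEmbed (1 : Equiv.Perm (Fin 1)) T Φ 0) :=
    (hW.isEternal_dssEmbed 0).isEternalVisc
  have h := dyadic_hasDerivAt_apply hE 0 x 0
  simp only [embed_apply, viscCoef, zero_mul, add_zero, zero_sub, zero_add, Int.cast_zero, sub_zero,
    Int.cast_one, one_mul, Int.cast_neg, neg_mul, sub_neg_eq_add, reduceIte] at h
  refine (h.congr_deriv ?_)
  ring

/-- Log-time of the retarded / advanced arguments (`s = e^{T}`): `−log(−t/s) = −log(−t) + T`,
`−log(−st) = −log(−t) − T`. [elementary] -/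
theorem logTime_div (t : ℝ) (ht : t < 0) (T : ℝ) :
    -Real.log (-(t / Real.exp T)) = -Real.log (-t) + T := by
  rw [show -(t / Real.exp T) = (-t) / Real.exp T by ring,
    Real.log_div (by linarith) (Real.exp_pos T).ne', Real.log_exp]
  ring

/-- [elementary] -/
theorem logTime_mul (t : ℝ) (ht : t < 0) (T : ℝ) :
    -Real.log (-(Real.exp T * t)) = -Real.log (-t) - T := by
  rw [show -(Real.exp T * t) = Real.exp T * (-t) by ring,
    Real.log_mul (Real.exp_pos T).ne' (by linarith), Real.log_exp]
  ring

/-- **Inverse dictionary, the equation.**  The scalar `a(t) = e^{x}(Φ 0 x)_0`, `x = −log(−t)`, solves the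
scalar front equation of `DyadicScalarFronts` with `s = e^{T}` on `t < 0`.
[cite: Tao2016AveragedNS, §1.2 (dyadic model), §4 Lemma 4.1 (4.8) in the self-similar variables of §6.4; cell theorem] -/
theorem front_hasDerivAt (hε : 0 < ε₀) (hW : IsDSSWave ε₀ dyadicTable (1 : Equiv.Perm (Fin 1)) T Φ)
    (t : ℝ) (ht : t < 0) :
    HasDerivAt (fun t => Real.exp (-Real.log (-t)) * Φ 0 (-Real.log (-t)) 0)
      (bigLam ε₀ / Real.exp T ^ 2
          * (Real.exp (-Real.log (-(t / Real.exp T))) * Φ 0 (-Real.log (-(t / Real.exp T))) 0) ^ 2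
        - Real.exp T / bigLam ε₀
          * (Real.exp (-Real.log (-t)) * Φ 0 (-Real.log (-t)) 0)
          * (Real.exp (-Real.log (-(Real.exp T * t))) * Φ 0 (-Real.log (-(Real.exp T * t))) 0)) t := by
  have hΛ : 0 < bigLam ε₀ := bigLam_pos (by linarith)
  set x : ℝ := -Real.log (-t) with hx
  -- the inner map `ℓ(t) = -log(-t)` and the outer map `g(x) = e^x φ(x)`
  have hℓ : HasDerivAt (fun t : ℝ => -Real.log (-t)) ((-t)⁻¹) t := by
    have h1 := ((Real.hasDerivAt_log (neg_ne_zero.2 ht.ne)).comp t (hasDerivAt_neg t)).neg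
    exact h1.congr_deriv (by ring)
  have hφ := hasDerivAt_comp0 hW x
  have hg : HasDerivAt (fun y => Real.exp y * Φ 0 y 0)
      (Real.exp x * Φ 0 x 0 + Real.exp x
        * (bigLam ε₀ * Φ 0 (x + T) 0 ^ 2 - (bigLam ε₀)⁻¹ * (Φ 0 x 0 * Φ 0 (x - T) 0) - Φ 0 x 0)) x :=
    (Real.hasDerivAt_exp x).mul hφ
  have hcomp := hg.comp t hℓ
  have hinv : (-t)⁻¹ = Real.exp x := by
    rw [hx, Real.exp_neg, Real.exp_log (by linarith)]
  rw [logTime_div t ht T, logTime_mul t ht T]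
  refine hcomp.congr_deriv ?_
  rw [hinv, Real.exp_add, Real.exp_sub]
  field_simp
  ring

/-- **Inverse dictionary, integrability**: `∫_{t<0}|a| = ∫_ℝ |φ| ≤ ∫ sMass Φ < ∞`.
[cite: Tao2016AveragedNS, §4; cell theorem] -/
theorem front_integrableOn (hε : 0 < ε₀) (hW : IsDSSWave ε₀ dyadicTable (1 : Equiv.Perm (Fin 1)) T Φ) :
    IntegrableOn (fun t => Real.exp (-Real.log (-t)) * Φ 0 (-Real.log (-t)) 0) (Iio 0) := by
  have hφc : Continuous (fun x => Φ 0 x 0) :=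
    continuous_iff_continuousAt.2 fun x => (hasDerivAt_comp0 hW x).continuousAt
  have hφi : Integrable (fun x => Φ 0 x 0) := by
    refine Integrable.mono' hW.mass hφc.aestronglyMeasurable (Eventually.of_forall fun x => ?_)
    rw [Real.norm_eq_abs, ← norm_eq_abs hε hW x]
    exact norm_le_sMass Φ x 0
  have hderiv : ∀ x ∈ (univ : Set ℝ), HasDerivWithinAt (fun x : ℝ => -Real.exp (-x))
      (Real.exp (-x)) univ x := by
    intro x _
    have h1 : HasDerivAt (fun y : ℝ => -Real.exp (-y)) (-(Real.exp (-x) * (-1))) x :=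
      ((Real.hasDerivAt_exp (-x)).comp x ((hasDerivAt_id x).neg)).neg
    exact (h1.congr_deriv (by ring)).hasDerivWithinAt
  have hinj : InjOn (fun x : ℝ => -Real.exp (-x)) univ := by
    intro x _ y _ hxy
    have : Real.exp (-x) = Real.exp (-y) := neg_injective hxy
    have := Real.exp_injective this
    linarith
  have key := (integrableOn_image_iff_integrableOn_abs_deriv_smul MeasurableSet.univ hderiv hinj
    (fun t => Real.exp (-Real.log (-t)) * Φ 0 (-Real.log (-t)) 0)).2 (by
      rw [integrableOn_univ]
      refine hφi.congr (Eventually.of_forall fun x => ?_)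
      simp only [neg_neg, Real.log_exp, smul_eq_mul, abs_of_pos (Real.exp_pos _)]
      rw [Real.exp_neg, ← mul_assoc, inv_mul_cancel₀ (Real.exp_pos _).ne', one_mul])
  rwa [image_neg_exp_neg] at key

/-- **Inverse dictionary, boundedness near `0⁻`**: `|a(t)| = √(e^{2x}‖Φ 0 x‖²) ≤ √P` on `[−e^{−x₀}, 0)`.
[cite: Tao2016AveragedNS, §4; cell theorem] -/
theorem front_bdd (hε : 0 < ε₀) (hW : IsDSSWave ε₀ dyadicTable (1 : Equiv.Perm (Fin 1)) T Φ) :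
    ∃ t₀ : ℝ, t₀ < 0 ∧ ∃ P : ℝ, ∀ t : ℝ, t₀ ≤ t → t < 0 →
      |Real.exp (-Real.log (-t)) * Φ 0 (-Real.log (-t)) 0| ≤ P := by
  obtain ⟨x₀, P, hP⟩ := hW.bdd
  refine ⟨-Real.exp (-x₀), neg_neg_iff_pos.2 (Real.exp_pos _), Real.sqrt P, fun t ht0 ht => ?_⟩
  set x : ℝ := -Real.log (-t) with hx
  have hxx : x₀ ≤ x := by
    rw [hx, le_neg, Real.log_le_iff_le_exp (by linarith)]
    linarith
  have hw := hP x hxx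
  unfold wEnergy sEnergy at hw
  simp only [Finset.univ_unique, Fin.default_eq_zero, Finset.sum_singleton, mul_one] at hw
  rw [norm_eq_abs hε hW x] at hw
  have h2 : (Real.exp x * Φ 0 x 0) ^ 2 ≤ P := by
    have : Real.exp (2 * x) = Real.exp x ^ 2 := by rw [← Real.exp_nat_mul]; norm_num
    rw [mul_pow, ← this, ← sq_abs (Φ 0 x 0)]; exact hw
  rw [abs_mul, abs_of_pos (Real.exp_pos x)]
  calc Real.exp x * |Φ 0 x 0| = |Real.exp x * Φ 0 x 0| := by
        rw [abs_mul, abs_of_pos (Real.exp_pos x)]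
    _ = Real.sqrt ((Real.exp x * Φ 0 x 0) ^ 2) := (Real.sqrt_sq_eq_abs _).symm
    _ ≤ Real.sqrt P := Real.sqrt_le_sqrt h2

/-- **Inverse dictionary, non-triviality**: a non-zero profile value gives a non-zero value of `a`.
[elementary] -/
theorem front_ne_zero (hε : 0 < ε₀) (hW : IsDSSWave ε₀ dyadicTable (1 : Equiv.Perm (Fin 1)) T Φ)
    {x : ℝ} (hne : Φ 0 x ≠ 0) :
    ∃ t : ℝ, t < 0 ∧ Real.exp (-Real.log (-t)) * Φ 0 (-Real.log (-t)) 0 ≠ 0 := by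
  refine ⟨-Real.exp (-x), neg_neg_iff_pos.2 (Real.exp_pos _), ?_⟩
  rw [neg_neg, Real.log_exp, neg_neg]
  refine mul_ne_zero (Real.exp_pos x).ne' fun h0 => hne ?_
  have := norm_eq_abs hε hW x
  rw [h0, abs_zero] at this
  exact norm_eq_zero.1 this

/-- **Every non-trivial admissible single-profile DSS wave of the dyadic member is STRICTLY sub-unitary:
`dssMu ε₀ T < 1`.** [cite: Tao2016AveragedNS, §1.2, §4 (4.1); cell theorem] -/
theorem dssMu_lt_one (hε : 0 < ε₀) (hW : IsDSSWave ε₀ dyadicTable (1 : Equiv.Perm (Fin 1)) T Φ)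
    (hne : ∃ x, Φ 0 x ≠ 0) : dssMu ε₀ T < 1 := by
  obtain ⟨x, hx⟩ := hne
  have hs : 1 < Real.exp T := by
    have := hW.delay_pos; rw [← Real.exp_zero]; exact Real.exp_lt_exp.2 this
  have h := (dssMu_lt_one_of_front hε hs (fun t ht => front_hasDerivAt hε hW t ht)
    (front_integrableOn hε hW) (front_bdd hε hW) (front_ne_zero hε hW hx)).2
  rwa [Real.log_exp] at h

/-- **… and it strands a positive wake**: `e^{x}(Φ 0 x)_0 → L > 0` as `x → +∞` (the K41-normalised tail
of the profile does not vanish). [cite: Tao2016AveragedNS, §1.2, §4; cell theorem] -/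
theorem wake_pos (hε : 0 < ε₀) (hW : IsDSSWave ε₀ dyadicTable (1 : Equiv.Perm (Fin 1)) T Φ)
    (hne : ∃ x, Φ 0 x ≠ 0) :
    ∃ L : ℝ, 0 < L ∧ Tendsto (fun x => Real.exp x * Φ 0 x 0) atTop (𝓝 L) := by
  obtain ⟨x, hx⟩ := hne
  have hs : 1 < Real.exp T := by
    have := hW.delay_pos; rw [← Real.exp_zero]; exact Real.exp_lt_exp.2 this
  obtain ⟨L, hL, hLpos⟩ := wake_pos_of_front hε hs (fun t ht => front_hasDerivAt hε hW t ht)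
    (front_integrableOn hε hW) (front_bdd hε hW) (front_ne_zero hε hW hx)
  refine ⟨L, hLpos, ?_⟩
  have hmap : Tendsto (fun y : ℝ => -Real.exp (-y)) atTop (𝓝[<] (0 : ℝ)) := by
    refine tendsto_nhdsWithin_of_tendsto_nhds_of_eventually_within _ ?_
      (Eventually.of_forall fun y => neg_neg_iff_pos.2 (Real.exp_pos _))
    have : Tendsto (fun y : ℝ => Real.exp (-y)) atTop (𝓝 0) :=
      Real.tendsto_exp_atBot.comp tendsto_neg_atTop_atBot
    simpa using this.neg
  have h := hL.comp hmap
  refine h.congr fun y => ?_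
  simp only [Function.comp, neg_neg, Real.log_exp]

/-- **`DyadicScalarFronts` ⟺ persistent non-trivial admissible single-profile DSS waves of the dyadic member
at arbitrarily small scale ratios** (the scalar reduction of the construction item loses nothing).
[cite: Tao2016AveragedNS, §1.2, §4; cell theorem] -/
theorem DyadicScalarFronts_iff :
    DyadicScalarFronts ↔
      ∀ ε : ℝ, 0 < ε → ∃ ε₀ : ℝ, 0 < ε₀ ∧ ε₀ ≤ ε ∧
        ∃ (T : ℝ) (Φ : Fin 1 → ℝ → Em 4),
          IsDSSWave ε₀ dyadicTable (1 : Equiv.Perm (Fin 1)) T Φ ∧ ∃ x, Φ 0 x ≠ 0 := by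
  constructor
  · intro hF ε hε
    obtain ⟨ε₀', hε₀', hle', s, hs, a, hode, hint, hbdd, t₁, ht₁, hne'⟩ := hF ε hε
    refine ⟨ε₀', hε₀', hle', Real.log s, _, isDSSWave_dyadic_of_scalarFront hε₀' hs hode hint hbdd,
      -Real.log (-t₁), ?_⟩
    have ht : -Real.exp (-(-Real.log (-t₁))) = t₁ := by
      rw [neg_neg, Real.exp_log (neg_pos.2 ht₁), neg_neg]
    rw [ht]
    intro h0
    rw [smul_eq_zero] at h0
    rcases h0 with h0 | h0
    · exact (mul_ne_zero (Real.exp_pos _).ne' hne') h0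
    · exact one_ne_zero ((PiLp.single_eq_zero_iff 2 (0 : Fin 4)).1 h0)
  · intro hF
    unfold DyadicScalarFronts
    intro ε hε
    obtain ⟨ε₀, hε₀, hle, T, Φ, hW, x, hx⟩ := hF ε hε
    have hs : 1 < Real.exp T := by
      have := hW.delay_pos; rw [← Real.exp_zero]; exact Real.exp_lt_exp.2 this
    refine ⟨ε₀, hε₀, hle, Real.exp T, hs, _, fun t ht => front_hasDerivAt hε₀ hW t ht,
      front_integrableOn hε₀ hW, front_bdd hε₀ hW, front_ne_zero hε₀ hW hx⟩

end WakeRatchetDyadicWaveStrict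

end Summit.NavierStokesRegularity.NavierStokesRegularity.Theorems

end
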